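import Summits.Ventures.HodgeRepro2.T5SU11JacobiKPartLaw
import Summits.Ventures.HodgeRepro2.T5BergmanPairing

/-!
# The phase of the lowest-weight matrix coefficient is uniform on the circle and independent of its modulus,
under every Jacobi density

The lowest-weight matrix coefficient of the weight-`k` Bergman model is `⟨π_k(g) 1, 1⟩_k = a(g)^{−k} ⟨1, 1⟩_k` with
`⟨1, 1⟩_k = π/(k − 1) > 0` (`T5BergmanCoefficient.pairing_act_lowest`, `T5BergmanPairing.pairing_lowest_lowest`), so its
phase is **`(kProj g)^{−k}`** (`phase_pairing_act_lowest`) and its modulus `|a(g)|^{−k} π/(k − 1)` is a function of the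
orbit point. The power map `u ↦ uⁿ` (`n ≠ 0`) of the circle is a continuous surjective endomorphism, so it preserves the
normalised Haar measure (**`map (· ^ n) dk = dk`**, `map_zpow_haarCircle`, by the uniqueness of Haar probability
measures; `integral_zpow_haarCircle`). With the law of the `K`-component (`T5SU11JacobiKPartLaw`):

* **the phase of the lowest-weight coefficient is uniform**: for every `(k', λ)` on the ray and every measurable `Ψ`,
  `E_{k',λ}[Ψ(phase ⟨π_k(g) 1, 1⟩_k)] = ∫_K Ψ dk` (`mean_phase_coefficient_eq`);
* **it is independent of everything that is a function of the orbit point** — in particular of the modulus of the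
  coefficient, of the phase `log|a(g)|` and of the orbit radius: `E[Φ(g·0) Ψ(phase ⟨π_k(g) 1, 1⟩_k)] = E[Φ(g·0)] · ∫_K Ψ dk`
  (`mean_orbit_mul_phase_coefficient_eq`).

The weight `k` of the coefficient and the weight `k'` of the density are independent parameters here. Nothing is
claimed about (N).

Blind lane: Mathlib + the HodgeRepro2 prefix only; no sorry; axioms ⊆ {propext, Classical.choice,
Quot.sound}.
-/

namespace Summit.Ventures.HodgeRepro2.T5SU11JacobiCoefficientPhaseLaw

open MeasureTheory MeasureTheory.Measure Metric Set Filter Topology Complex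
open T5PoincareDensity T5PoincareMeasure T5SU11Unimodular T5SU11Fibration T5SU11FibrationHaar T5SU11Cartan
  T5HaarCircle T5BergmanCoefficient T5BergmanPairing T5SU11KProjection T5SU11FibrationCocycle T5SU11OrbitMeasure
  T5SU11SphericalFunction T5SU11JacobiWeight T5SU11KFiniteMajorantPow T5SU11JacobiKPartLaw
open scoped Real

/-! ### The phase of the lowest-weight coefficient -/

/-- `phase (z⁻¹ ^ k) = (phase z)⁻¹ ^ k` for `z ≠ 0`. -/
theorem phase_inv_pow {z : ℂ} (hz : z ≠ 0) (k : ℕ) : phase (z⁻¹ ^ k) = (phase z)⁻¹ ^ k := by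
  apply Circle.ext
  have hzk : z⁻¹ ^ k ≠ 0 := pow_ne_zero k (inv_ne_zero hz)
  rw [Circle.coe_pow, Circle.coe_inv, coe_phase hzk, coe_phase hz, norm_pow, norm_inv]
  have hn : ((‖z‖ : ℝ) : ℂ) ≠ 0 := by exact_mod_cast norm_ne_zero_iff.mpr hz
  push_cast
  rw [inv_div, ← div_pow]
  congr 1
  field_simp

/-- **The phase of the lowest-weight coefficient is `(kProj g)^{−k}`**: for `k ≥ 2`,
`phase ⟨π_k(g) 1, 1⟩_k = (kProj g)⁻¹ ^ k`. -/
theorem phase_pairing_act_lowest {k : ℕ} (hk : 2 ≤ k) (g : SU11) :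
    phase (pairing k (act k g lowest) lowest) = (kProj g)⁻¹ ^ k := by
  have ha : mat g 0 0 ≠ 0 := mat_zero_zero_ne_zero g
  have hc : (0 : ℝ) < π / ((k : ℝ) - 1) := by
    have : (2 : ℝ) ≤ k := by exact_mod_cast hk
    exact div_pos Real.pi_pos (by linarith)
  rw [pairing_act_lowest, pairing_lowest_lowest k hk, phase_mul (pow_ne_zero k (inv_ne_zero ha)) (by
    exact_mod_cast hc.ne'), phase_ofReal_of_pos hc, mul_one, phase_inv_pow ha]
  rfl

/-! ### The power map preserves the Haar measure of the circle -/

section measure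

variable [MeasurableSpace Circle] [BorelSpace Circle]

omit [MeasurableSpace Circle] [BorelSpace Circle] in
/-- The power map `u ↦ uⁿ` of the circle is surjective for `n ≠ 0` (`n`-th roots through `Circle.exp`). -/
theorem zpow_surjective_circle {n : ℤ} (hn : n ≠ 0) : Function.Surjective fun u : Circle => u ^ n := by
  intro v
  refine ⟨Circle.exp (Complex.arg (v : ℂ) / n), ?_⟩
  simp only
  rw [← Circle.exp_zsmul, zsmul_eq_mul, mul_div_cancel₀ _ (by exact_mod_cast hn), Circle.exp_arg]

/-- **The power map preserves the normalised Haar measure of the circle**: `map (· ^ n) dk = dk` for `n ≠ 0`. -/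
theorem map_zpow_haarCircle {n : ℤ} (hn : n ≠ 0) :
    Measure.map (fun u : Circle => u ^ n) haarCircle = haarCircle := by
  have hcont : Continuous fun u : Circle => u ^ n := continuous_zpow n
  haveI : IsHaarMeasure (Measure.map (fun u : Circle => u ^ n) haarCircle) :=
    isHaarMeasure_map_of_isFiniteMeasure haarCircle (zpowGroupHom n) hcont (zpow_surjective_circle hn)
  haveI : IsProbabilityMeasure (Measure.map (fun u : Circle => u ^ n) haarCircle) :=
    Measure.isProbabilityMeasure_map hcont.measurable.aemeasurable
  exact isHaarMeasure_eq_of_isProbabilityMeasure _ _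

/-- `∫_K Ψ(uⁿ) du = ∫_K Ψ(u) du` for `n ≠ 0` and measurable `Ψ`. -/
theorem integral_zpow_haarCircle {n : ℤ} (hn : n ≠ 0) {Ψ : Circle → ℝ} (hΨ : Measurable Ψ) :
    ∫ u, Ψ (u ^ n) ∂haarCircle = ∫ u, Ψ u ∂haarCircle := by
  have hcont : Continuous fun u : Circle => u ^ n := continuous_zpow n
  rw [← integral_map hcont.measurable.aemeasurable (hΨ.aestronglyMeasurable), map_zpow_haarCircle hn]

/-! ### The law of the phase of the coefficient under the explicit model -/

/-- **THE PHASE OF THE LOWEST-WEIGHT COEFFICIENT IS UNIFORM**: on the ray, for `k ≥ 2` and measurable `Ψ`,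
`E_{k',λ}[Ψ(phase ⟨π_k(g) 1, 1⟩_k)] = ∫_K Ψ dk`. -/
theorem mean_phase_coefficient_eq {k' lam : ℝ} (hk' : 1 < k') (h1 : lam < k') (h2 : 2 < k' + lam) {k : ℕ}
    (hk : 2 ≤ k) {Ψ : Circle → ℝ} (hΨ : Measurable Ψ) :
    (∫ g, Ψ (phase (pairing k (act k g lowest) lowest)) * ((1 - ‖orbit g‖ ^ 2) ^ (k' / 2) * sph lam g)
        ∂(nu haarCircle))
        / (∫ g, (1 - ‖orbit g‖ ^ 2) ^ (k' / 2) * sph lam g ∂(nu haarCircle))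
      = ∫ u, Ψ u ∂haarCircle := by
  have hΨ' : Measurable fun u : Circle => Ψ ((u ^ k)⁻¹) := hΨ.comp ((continuous_pow k).inv.measurable)
  have e : ∀ g : SU11, Ψ (phase (pairing k (act k g lowest) lowest)) = Ψ ((kProj g ^ k)⁻¹) := fun g => by
    rw [phase_pairing_act_lowest hk g, inv_pow]
  simp_rw [e]
  rw [mean_kProj_eq hk' h1 h2 hΨ']
  have := integral_zpow_haarCircle (n := -(k : ℤ)) (by omega) hΨ
  simp only [zpow_neg, zpow_natCast] at this
  exact this

/-- **INDEPENDENCE FROM THE ORBIT POINT** (hence from the modulus of the coefficient, the phase `log|a|` and the orbit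
radius): on the ray, for `k ≥ 2` and measurable `Φ`, `Ψ`,
`E_{k',λ}[Φ(g·0) Ψ(phase ⟨π_k(g) 1, 1⟩_k)] = E_{k',λ}[Φ(g·0)] · ∫_K Ψ dk`. -/
theorem mean_orbit_mul_phase_coefficient_eq {k' lam : ℝ} (hk' : 1 < k') (h1 : lam < k') (h2 : 2 < k' + lam)
    {k : ℕ} (hk : 2 ≤ k) {Φ : ℂ → ℝ} {Ψ : Circle → ℝ} (hΦ : Measurable Φ) (hΨ : Measurable Ψ) :
    (∫ g, Φ (orbit g) * Ψ (phase (pairing k (act k g lowest) lowest))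
          * ((1 - ‖orbit g‖ ^ 2) ^ (k' / 2) * sph lam g) ∂(nu haarCircle))
        / (∫ g, (1 - ‖orbit g‖ ^ 2) ^ (k' / 2) * sph lam g ∂(nu haarCircle))
      = ((∫ g, Φ (orbit g) * ((1 - ‖orbit g‖ ^ 2) ^ (k' / 2) * sph lam g) ∂(nu haarCircle))
          / (∫ g, (1 - ‖orbit g‖ ^ 2) ^ (k' / 2) * sph lam g ∂(nu haarCircle)))
        * ∫ u, Ψ u ∂haarCircle := by
  have hΨ' : Measurable fun u : Circle => Ψ ((u ^ k)⁻¹) := hΨ.comp ((continuous_pow k).inv.measurable)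
  have e : ∀ g : SU11, Ψ (phase (pairing k (act k g lowest) lowest)) = Ψ ((kProj g ^ k)⁻¹) := fun g => by
    rw [phase_pairing_act_lowest hk g, inv_pow]
  simp_rw [e]
  rw [mean_orbit_mul_kProj_eq hk' h1 h2 hΦ hΨ']
  have := integral_zpow_haarCircle (n := -(k : ℤ)) (by omega) hΨ
  simp only [zpow_neg, zpow_natCast] at this
  rw [this]

end measure

end Summit.Ventures.HodgeRepro2.T5SU11JacobiCoefficientPhaseLaw
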